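import Literature.Analysis.FluidPDE.OnsagerFlexibilityHolds
import Literature.Analysis.FluidPDE.OnsagerBDSVPerturbationAssembly
import Literature.Analysis.FluidPDE.OnsagerBDSVIncrementEstimateProofs
import Literature.Analysis.FluidPDE.OnsagerBDSVEnergyEstimateHolds
import HarnessLib

/-!
# Discharges of `BDSV.gluingStage` and `BDSV.perturbationStage` (Buckmaster–De Lellis–Székelyhidi–Vicol 2019, Prop. 2.2 stages)

Topic `Literature/Analysis/FluidPDE`. Pure bookkeeping: the two stage facts of
`OnsagerBDSVThreeStages.lean` (the gluing stage, §4 / Prop. 4.1 with §3, and the perturbation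
stage, §§5–7 / §§5–6 of [BuckmasterEtAl2018]) had all their inputs discharged in the tree —
`BDSV.gluingStability_holds`, `BDSV.gluedTripleEstimates_holds`, `Torus.eulerSmoothShortTime_holds`
(`OnsagerFlexibilityHolds` closure), `BDSV.incrementEstimate_holds`, `BDSV.stressEstimate_holds`,
`BDSV.energyEstimate_holds` — and accepted reductions
`BDSV.gluingStage_of_shortTime_of_stability_of_glued` (`OnsagerBDSVMainReduction`) and
`BDSV.perturbationStage_of_three` (`OnsagerBDSVPerturbationAssembly`) consume exactly those, but
nobody had written the two closing lines (librarian g31 composition scan, 2026-08-17). The sibling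
facts `stagesEstimate`, `mainIteration`, `onsager_flexibility` were closed the same way in
`OnsagerFlexibilityHolds.lean` (g30). Types are written fully qualified (the `dedup.landed` check
compares statement text; `DeRosa.gluingStage` is a different constant with the same short name).

## References

* T. Buckmaster, C. De Lellis, L. Székelyhidi Jr., V. Vicol, *Onsager's conjecture for admissible
  weak solutions*, CPAM 72 (2019), Prop. 2.2, Prop. 4.1, Props. 6.1–6.2. [BuckmasterEtAl2018]
-/

noncomputable section

namespace Literature.Analysis.FluidPDE

namespace BDSV

/-- **Discharge of `BDSV.gluingStage`** (BDSV 2019, Prop. 4.1 with the short-time Euler theory of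
§3): the accepted reduction `gluingStage_of_shortTime_of_stability_of_glued` fed with the three
proved inputs. [cite: BuckmasterEtAl2018, §2.5 (2.17)–(2.22), Prop. 4.1] -/
theorem gluingStage_holds : _root_.Literature.Analysis.FluidPDE.BDSV.gluingStage :=
  gluingStage_of_shortTime_of_stability_of_glued Torus.eulerSmoothShortTime_holds
    gluingStability_holds gluedTripleEstimates_holds

/-- **Discharge of `BDSV.perturbationStage`** (BDSV 2019, Prop. 5.1, §§5–7): the accepted
reduction `perturbationStage_of_three` fed with the proved increment, stress and energy
estimates. [cite: BuckmasterEtAl2018, §2.6 (2.23)–(2.24c), Cor. 5.8, Props. 6.1–6.2] -/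
theorem perturbationStage_holds : _root_.Literature.Analysis.FluidPDE.BDSV.perturbationStage :=
  perturbationStage_of_three incrementEstimate_holds stressEstimate_holds energyEstimate_holds

end BDSV

end Literature.Analysis.FluidPDE

end
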